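import Summits.Ventures.CertifiedManyBodySolver.Downfold.BoxesLa214V115M2cPhaseSeparation
import Summits.Ventures.CertifiedManyBodySolver.Certificates.HubbardSquare_varbox_planes_r450
import Literature.MathematicalPhysics.QuantumLattice.HubbardFermiSeaTangentRowsTwoFifths
import HarnessLib
import HarnessLib.Audit

/-!
# Ventures/CertifiedManyBodySolver — Observables/PhaseSeparationExclusionTPrimeStripTwoFifths.lean (COMPETING-ORDER word on the cuprate `t′`-STRIP with the STRONGEST off-axis threshold so far: phase-separation exclusion `(≤ 2/5 | ≥ 1)` on `t′ ∈ [−3/10, 0] × U ∈ [15/2, 17/2]` — the FILLING-3/4 VARBOX cap plane of CERTIFIED #450's witness, read over `(t′, U)` with its `t′`-slope KEPT)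

HONEST FRAMING: first certified bounds; not a superconductivity verdict. CLASS = DERIVED / CONTEXT: instantiation of PROVED tree laws
(`Observables/PhaseSeparationExclusionBox`: `ps_not_groundState_mix_on_cell_of_fns`, here through two new column forms with a `t′`-AFFINE
cap, §0) on CLAIM NODES BY NAME: the VARBOX plane `cert_r450_openbox_32x4_N96_planes` (the open-box `32 × 4`, `N = 96` MPS witness of
CERTIFIED #450 at `(8, 3/4, 0)`; `r450_plane_of`: for every real `t′` and `U ≥ 0`, `e(1,t′,U,3/4) ≤ (E_K + max(t′E_P, −t′E_M) + U·E_D)/128`),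
the K2DIAG-A bootstraps `cert_laBoxE_K2diag_GU29o5n1tpm3o10_j295889_up` / `cert_laBoxE_K2diag_GU8n1tpm3o10_j299783_up` (affine-in-`t′`
half-filling floors on `t′ ∈ [−3/10, 0]` at `U = 29/5`, `8`; hubbard-obs-p2, wrapped by hubbard-downfold-unc-2 as `lsco_n1_law8_of` /
`lsco_n1_lawAt_of`), registry #21 · #487 · #427 · #488 · #472 · #428 — plus PREMISE-FREE kernel Fermi-sea tangent rows touching `2/5`
(`HubbardFermiSeaTangentRowsTwoFifths`, this seat). No new certificate, no CERTIFIED row, no cell word of the meter's kind, no MOVE. Seat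
hubbard-box-p3 g26 (`prover-hubbard-box-p3-g26-0`, S2 «t′-boxes from the t′ ∈ {0, −1/4} anchors»); generator `work/strip/emit_strip25.py`
(exact `fractions`; decimals = 10-place DOWNWARD roundings).

THE POINT. A phase-separation-exclusion sentence `(≤ n₁ | ≥ 1)` needs a CAP at ONE density strictly between `n₁` and `1` — and excludes the
`(≤ n₁ | ≥ 1)` mixtures at EVERY filling (super-segment law). The strip sentences of record (`PhaseSeparationExclusionTPrimeStripCuprate`,
`Downfold/BoxesLa214V115M2cPhaseSeparation{,Dilute}`) use the filling-`7/8` VARBOX plane of #445's witness and reach `n₁ = 3/10` at best; the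
registry also holds the filling-`3/4` witness plane **r450** (`E_K = −153806743957129/2⁴⁰ ≈ −139.886`, `E_P ≈ −38.5089`, `E_M ≈ +38.5089`,
`E_D ≈ 3.6057` on `128` sites): on the hole-doped half plane `t′ ≤ 0` it reads `e(1,s,U,3/4) ≤ c₀ + c_s·s + c₁·U` with
`c₀ = -1.0928626463…`, `c_s = −E_M/128 = -0.3008506581…` (the cap RISES by `0.30085·|s|`), `c₁ = 0.0281698162…` (§1). With the mean density at
`3/4` the lever arm of the dilute floor is `a = (1 − 3/4)/(1 − n₁)`: at `n₁ = 2/5`, `(a, b) = (5/12, 7/12)` and the margin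
`M(s, U) = a·F₁(s) + b·L_U(s) − (c₀ + c_s s + c₁ U)` is positive on the whole strip (three `t′`-cells, dilute floors = `t′`-chords of the
kernel rows at `−3/10, −1/4, −1/5, 0` touching `2/5`; exact margins, 10-dp down, at `(s₁ | s₂)`):
* L `[−3/10, −1/4] × [15/2, 17/2]`: `U = 15/2`: 0.0011394954 | 0.0108195099; `U = 8`: 0.0152020468 | 0.0237622386; `U = 17/2`: 0.0011171386 | 0.0096773305.
* M `[−1/4, −1/5] × [71/10, 44/5]`: `U = 71/10`: 0.0004653269 | 0.0109709485; `U = 8`: 0.0237622386 | 0.0322521796; `U = 44/5`: 0.0012263856 | 0.0097163266.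
* R `[−1/5, 0] × [133/20, 91/10]`: `U = 133/20`: 0.0003303330 | 0.0454031611; `U = 8`: 0.0322521796 | 0.0652309237; `U = 91/10`: 0.0012653817 | 0.0342441258.

WHAT IT SAYS (`t = 1`, thermodynamic limit; conditional BY NAME on the nodes above): **for every `t′ ∈ [−3/10, 0]` and every `U ∈ [15/2, 17/2]`
(`cuprateStrip_not_groundState_mix_le_2o5_ge_one`; wider `U`-ranges per `t′`-cell), no macroscopic mixture `λω₁ + (1−λ)ω₂` (`0 < λ < 1`) of
translation-invariant states of the 2D `t–t′` Hubbard model with densities `0 < ρ(ω₁) ≤ 2/5` and `1 ≤ ρ(ω₂) < 2` is a ground state — at ANY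
filling in between (`7/8`, `3/4`, …): the hole-doped ground states across the whole cuprate `t′/t`-range at `U/t ≈ 8` do not separate into the
half-filled (or denser) phase and a phase of hole doping `≥ 60 %`.** (The `(≤ 9/20 | ≥ 1)` margin with this cap is `−0.02…+0.003` — not certified;
`(≤ 1/2 | ≥ 1)` off the `t′ = 0` axis still needs a certified floor at density `1/2`, `t′ ≠ 0`.)
WHAT THIS IS NOT: a certificate; a CERTIFIED row; a statement at `t′ > 0`, `T > 0`, or about superconductivity; periodic (striped / Néel)
COMPONENTS are covered by the companion one-liners `PhaseSeparationExclusionPeriodicPhasesTPrimeStripTwoFifths`.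
[cite: Israel1979, Thm. I.2.4] [cite: EmeryKivelsonLin1990, pp. 475–476] [cite: Ruelle1969, §3.3] [cite: Griffiths1966, §II] [cite: LiebLoss1993, §8, Theorem 8.2]
-/

noncomputable section

namespace Summit.Ventures.CertifiedManyBodySolver.Observables

open Summit.Ventures.CertifiedManyBodySolver.Certificates Summit.Ventures.CertifiedManyBodySolver.Downfold
open Literature.MathematicalPhysics.QuantumLattice Literature.MathematicalPhysics.QuantumLattice.ThermodynamicLimit
open Literature.MathematicalPhysics.QuantumLattice.InfVolFermionState Set

/-! ## §0 Column forms of the cell law with a `t′`-AFFINE cap `c₀ + c_s·s + c₁·U` (generic; any densities) -/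

/-- **PS EXCLUSION ON A CELL, COLUMN FORM, `t′`-AFFINE CAP.** As `ps_not_groundState_mix_on_cell_of_columns` (cell `[s₁, s₂] × [U₁, U₂]`,
`0 ≤ U₁ < U₂`; densities `n₁ < n₂` in `[0, 2)`, weights `a + b = 1`), but the cap at the mean density is `c₀ + c_s·s + c₁·U` (affine in
`t′` AND `U` — the shape of an open-box witness PLANE on a half plane of fixed `t′`-sign); column laws `L_i(s) ≤ e(t, s, U_i, n₂)`, a floor
function `F₁(s) ≤ e(t, s, U, n₁)` on the cell, and POSITIVE COLUMN MARGINS `c₀ + c_s s + c₁U_i < a F₁(s) + b L_i(s)` for every `s`. The margin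
at `(s, U)` is the `U`-chord of the two column margins. [cite: Israel1979, Thm. I.2.4] [cite: EmeryKivelsonLin1990, pp. 475–476] [cite: Ruelle1969, §3.3] -/
theorem ps_not_groundState_mix_on_cell_of_columns_tcap (t : ℝ) {s₁ s₂ U₁ U₂ n₁ n₂ a b c₀ cs c₁ : ℝ} (hU₁ : 0 ≤ U₁)
    (h12 : U₁ < U₂) (hn₁ : 0 ≤ n₁) (hn : n₁ < n₂) (hn₂ : n₂ < 2) (ha : 0 ≤ a) (hb : 0 ≤ b) (hab : a + b = 1)
    {L₁ L₂ F₁ : ℝ → ℝ}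
    (hC : ∀ s ∈ Icc s₁ s₂, ∀ U ∈ Icc U₁ U₂, energyDensityTT' t s U (a * n₁ + b * n₂) ≤ c₀ + cs * s + c₁ * U)
    (hL₁ : ∀ s ∈ Icc s₁ s₂, L₁ s ≤ energyDensityTT' t s U₁ n₂) (hL₂ : ∀ s ∈ Icc s₁ s₂, L₂ s ≤ energyDensityTT' t s U₂ n₂)
    (hF₁ : ∀ s ∈ Icc s₁ s₂, ∀ U ∈ Icc U₁ U₂, F₁ s ≤ energyDensityTT' t s U n₁)
    (hm₁ : ∀ s ∈ Icc s₁ s₂, c₀ + cs * s + c₁ * U₁ < a * F₁ s + b * L₁ s)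
    (hm₂ : ∀ s ∈ Icc s₁ s₂, c₀ + cs * s + c₁ * U₂ < a * F₁ s + b * L₂ s)
    {s : ℝ} (hs : s ∈ Icc s₁ s₂) {U : ℝ} (hU : U ∈ Icc U₁ U₂)
    {ω₁ ω₂ : InfVolFermionState 2} (h₁ : ω₁.IsTranslationInvariant) (h₂ : ω₂.IsTranslationInvariant)
    (hρ₁ : 0 < ω₁.density) (hρ₁' : ω₁.density ≤ n₁) (hρ₂ : n₂ ≤ ω₂.density) (hρ₂' : ω₂.density < 2)
    {lam : ℝ} (hl0 : 0 < lam) (hl1 : lam < 1) :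
    energyDensityTT' t s U (mix lam hl0.le hl1.le ω₁ ω₂).density <
      (mix lam hl0.le hl1.le ω₁ ω₂).meanEnergy (hubbardTTPrimeFermionInteraction t s U) 1 := by
  have hn2' : 0 ≤ n₂ := hn₁.trans hn.le
  refine ps_not_groundState_mix_on_cell_of_fns t hU₁ hn ha hb hab (C := fun s U => c₀ + cs * s + c₁ * U)
    (F₁ := fun s _ => F₁ s) (F₂ := fun s U => ((U₂ - U) * L₁ s + (U - U₁) * L₂ s) / (U₂ - U₁)) hC hF₁
    (floor_on_cell_of_columnLaws t hn2' hn₂ hU₁ h12 hL₁ hL₂) ?_ hs hU h₁ h₂ hρ₁ hρ₁' hρ₂ hρ₂' hl0 hl1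
  intro s hs U hU
  have hpos := uchord_pos_of_ends h12 hU (sub_pos.2 (hm₁ s hs)) (sub_pos.2 (hm₂ s hs))
  have hd : (U₂ - U₁) ≠ 0 := (sub_pos.2 h12).ne'
  have hid : a * F₁ s + b * (((U₂ - U) * L₁ s + (U - U₁) * L₂ s) / (U₂ - U₁)) - (c₀ + cs * s + c₁ * U) =
      ((U₂ - U) * (a * F₁ s + b * L₁ s - (c₀ + cs * s + c₁ * U₁)) +
        (U - U₁) * (a * F₁ s + b * L₂ s - (c₀ + cs * s + c₁ * U₂))) / (U₂ - U₁) := by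
    field_simp
    ring
  have h := hid ▸ hpos
  show c₀ + cs * s + c₁ * U < a * F₁ s + b * (((U₂ - U) * L₁ s + (U - U₁) * L₂ s) / (U₂ - U₁))
  linarith

/-- **PS EXCLUSION ABOVE A COLUMN, `t′`-AFFINE CAP.** As `ps_not_groundState_mix_above_column`: for `U ∈ [U₂, U₃]` (`U₂ ≥ 0`) a cap
`c₀ + c_s·s + c₁·U` with `c₁ ≥ 0`, ONE column law `L(s) ≤ e(t, s, U₂, n₂)` (Griffiths: it floors every `U ≥ U₂`), a floor function `F₁(s)`
at `n₁`, and the margin positive at the FAR end `U₃` for every `s`. [cite: Israel1979, Thm. I.2.4] [cite: Griffiths1966, §II] -/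
theorem ps_not_groundState_mix_above_column_tcap (t : ℝ) {s₁ s₂ U₂ U₃ n₁ n₂ a b c₀ cs c₁ : ℝ} (hU₂ : 0 ≤ U₂)
    (hc₁ : 0 ≤ c₁) (hn₁ : 0 ≤ n₁) (hn : n₁ < n₂) (hn₂ : n₂ < 2) (ha : 0 ≤ a) (hb : 0 ≤ b) (hab : a + b = 1)
    {L F₁ : ℝ → ℝ}
    (hC : ∀ s ∈ Icc s₁ s₂, ∀ U ∈ Icc U₂ U₃, energyDensityTT' t s U (a * n₁ + b * n₂) ≤ c₀ + cs * s + c₁ * U)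
    (hL : ∀ s ∈ Icc s₁ s₂, L s ≤ energyDensityTT' t s U₂ n₂)
    (hF₁ : ∀ s ∈ Icc s₁ s₂, ∀ U ∈ Icc U₂ U₃, F₁ s ≤ energyDensityTT' t s U n₁)
    (hm : ∀ s ∈ Icc s₁ s₂, c₀ + cs * s + c₁ * U₃ < a * F₁ s + b * L s)
    {s : ℝ} (hs : s ∈ Icc s₁ s₂) {U : ℝ} (hU : U ∈ Icc U₂ U₃)
    {ω₁ ω₂ : InfVolFermionState 2} (h₁ : ω₁.IsTranslationInvariant) (h₂ : ω₂.IsTranslationInvariant)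
    (hρ₁ : 0 < ω₁.density) (hρ₁' : ω₁.density ≤ n₁) (hρ₂ : n₂ ≤ ω₂.density) (hρ₂' : ω₂.density < 2)
    {lam : ℝ} (hl0 : 0 < lam) (hl1 : lam < 1) :
    energyDensityTT' t s U (mix lam hl0.le hl1.le ω₁ ω₂).density <
      (mix lam hl0.le hl1.le ω₁ ω₂).meanEnergy (hubbardTTPrimeFermionInteraction t s U) 1 := by
  have hn2' : 0 ≤ n₂ := hn₁.trans hn.le
  refine ps_not_groundState_mix_on_cell_of_fns t hU₂ hn ha hb hab (C := fun s U => c₀ + cs * s + c₁ * U)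
    (F₁ := fun s _ => F₁ s) (F₂ := fun s _ => L s) hC hF₁
    (fun s hs U hU => floor_above_column_of_law t hn2' hn₂ hU₂ hL s hs U hU.1) ?_ hs hU h₁ h₂ hρ₁ hρ₁' hρ₂ hρ₂'
    hl0 hl1
  intro s hs U hU
  have k := mul_le_mul_of_nonneg_left hU.2 hc₁
  have := hm s hs
  show c₀ + cs * s + c₁ * U < a * F₁ s + b * L s
  linarith

/-! ## §1 The cap: the filling-`3/4` VARBOX plane r450 on the hole-doped half plane `t′ ≤ 0`, `t′`-slope kept -/

/-- **VARBOX cap at filling `3/4`, affine in `(t′, U)` on `t′ ≤ 0`**: `e(1, s, U, 3/4) ≤ c₀ + c_s·s + c₁·U` for every `s ≤ 0`, `U ≥ 0`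
with `c₀ = E_K/128`, `c_s = −E_M/128`, `c₁ = E_D/128` of `r450_plane_of` (its `t′`-term `max(s·E_P, −s·E_M)` equals `−s·E_M` for `s ≤ 0`,
since `E_P + E_M ≥ 0`). [cite: Ruelle1969, §3.3] -/
theorem r450_capPlane_tcap_of (h450 : cert_r450_openbox_32x4_N96_planes) {s : ℝ} (hs : s ≤ 0) {U : ℝ} (hU : 0 ≤ U) :
    energyDensityTT' 1 s U (3 / 4) ≤ ((-153806743957129/140737488355328 : ℚ) : ℝ) + ((-10585241497169/35184372088832 : ℚ) : ℝ) * s + ((3964549190109/140737488355328 : ℚ) : ℝ) * U := by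
  have h := r450_plane_of h450 s hU
  have hmax : max (s * ((-2646310369363/68719476736 : ℚ) : ℝ)) (-s * ((10585241497169/274877906944 : ℚ) : ℝ)) ≤ -s * ((10585241497169/274877906944 : ℚ) : ℝ) := by
    refine max_le ?_ le_rfl
    push_cast; nlinarith
  have h2 : (((-153806743957129/1099511627776 : ℚ) : ℝ) + max (s * ((-2646310369363/68719476736 : ℚ) : ℝ)) (-s * ((10585241497169/274877906944 : ℚ) : ℝ)) + U * ((3964549190109/1099511627776 : ℚ) : ℝ)) / ((32 : ℝ) * (4 : ℝ)) ≤
      (((-153806743957129/1099511627776 : ℚ) : ℝ) + (-s * ((10585241497169/274877906944 : ℚ) : ℝ)) + U * ((3964549190109/1099511627776 : ℚ) : ℝ)) / ((32 : ℝ) * (4 : ℝ)) :=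
    div_le_div_of_nonneg_right (by linarith) (by norm_num)
  refine h.trans (h2.trans (le_of_eq ?_))
  push_cast; ring

/-- **Cell form** (the shape `ps_not_groundState_mix_on_cell_of_columns_tcap` consumes; the density slot written as the weights' combination
`a·n₁ + b·n₂ = 3/4`): for `s ∈ [s₁, s₂]` with `s₂ ≤ 0` and `U ∈ [U₁, U₂]` with `U₁ ≥ 0`. [cite: Ruelle1969, §3.3] -/
theorem r450_capPlane_tcap_on_cell_of (h450 : cert_r450_openbox_32x4_N96_planes) {s₁ s₂ U₁ U₂ a n₁ b n₂ : ℝ}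
    (hs₂ : s₂ ≤ 0) (hU₁ : 0 ≤ U₁) (hab : a * n₁ + b * n₂ = 3 / 4) :
    ∀ s ∈ Icc s₁ s₂, ∀ U ∈ Icc U₁ U₂, energyDensityTT' 1 s U (a * n₁ + b * n₂) ≤
      ((-153806743957129/140737488355328 : ℚ) : ℝ) + ((-10585241497169/35184372088832 : ℚ) : ℝ) * s + ((3964549190109/140737488355328 : ℚ) : ℝ) * U := by
  intro s hs U hU
  rw [hab]
  exact r450_capPlane_tcap_of h450 (hs.2.trans hs₂) (hU₁.trans hU.1)

/-! ## §2 Dilute floors at density `2/5` on the three `t′`-cells: `t′`-chords of kernel Fermi-sea tangent rows (premise-free, every `U ≥ 0`) -/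

/-- **Dilute floor on `t′ ∈ [-3/10, -1/4]`, rows touching at `2/5`** (any density `0 ≤ n₁ < 2`, every `U ≥ 0`): the `t′`-chord of
`fermiSeaTangentRow_tPrime_neg_three_div_ten_at_two_div_five` and `fermiSeaTangentRow_tPrime_neg_one_div_four_at_two_div_five`. [cite: LiebLoss1993, §8, Theorem 8.2] [cite: Ruelle1969, §3.3] -/
theorem strip25_dilute_floor_left {n₁ : ℝ} (hn0 : 0 ≤ n₁) (hn2 : n₁ < 2) :
    ∀ s ∈ Icc (-3 / 10 : ℝ) (-1 / 4), ∀ U : ℝ, 0 ≤ U →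
      (((-1 / 4) - s) * ((-0.1999840521 : ℝ) + (-3679 / 2048) * n₁) + (s - (-3 / 10)) * ((-0.2414810972 : ℝ) + (-3661 / 2048) * n₁)) / ((-1 / 4) - (-3 / 10)) ≤
        energyDensityTT' 1 s U n₁ :=
  floor_on_cell_of_tPrime_end_rows 1 hn0 hn2 (by norm_num)
    (fun _ hU => fermiSeaTangentRow_tPrime_neg_three_div_ten_at_two_div_five hU hn0 hn2)
    (fun _ hU => fermiSeaTangentRow_tPrime_neg_one_div_four_at_two_div_five hU hn0 hn2)

/-- **Dilute floor on `t′ ∈ [-1/4, -1/5]`, rows touching at `2/5`** (any density `0 ≤ n₁ < 2`, every `U ≥ 0`): the `t′`-chord of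
`fermiSeaTangentRow_tPrime_neg_one_div_four_at_two_div_five` and `fermiSeaTangentRow_tPrime_neg_one_div_five_at_two_div_five`. [cite: LiebLoss1993, §8, Theorem 8.2] [cite: Ruelle1969, §3.3] -/
theorem strip25_dilute_floor_mid {n₁ : ℝ} (hn0 : 0 ≤ n₁) (hn2 : n₁ < 2) :
    ∀ s ∈ Icc (-1 / 4 : ℝ) (-1 / 5), ∀ U : ℝ, 0 ≤ U →
      (((-1 / 5) - s) * ((-0.2414810972 : ℝ) + (-3661 / 2048) * n₁) + (s - (-1 / 4)) * ((-0.2666428382 : ℝ) + (-7455 / 4096) * n₁)) / ((-1 / 5) - (-1 / 4)) ≤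
        energyDensityTT' 1 s U n₁ :=
  floor_on_cell_of_tPrime_end_rows 1 hn0 hn2 (by norm_num)
    (fun _ hU => fermiSeaTangentRow_tPrime_neg_one_div_four_at_two_div_five hU hn0 hn2)
    (fun _ hU => fermiSeaTangentRow_tPrime_neg_one_div_five_at_two_div_five hU hn0 hn2)

/-- **Dilute floor on `t′ ∈ [-1/5, 0]`, rows touching at `2/5`** (any density `0 ≤ n₁ < 2`, every `U ≥ 0`): the `t′`-chord of
`fermiSeaTangentRow_tPrime_neg_one_div_five_at_two_div_five` and `fermiSeaTangentRow_tPrime_zero_at_two_div_five`. [cite: LiebLoss1993, §8, Theorem 8.2] [cite: Ruelle1969, §3.3] -/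
theorem strip25_dilute_floor_right {n₁ : ℝ} (hn0 : 0 ≤ n₁) (hn2 : n₁ < 2) :
    ∀ s ∈ Icc (-1 / 5 : ℝ) (0), ∀ U : ℝ, 0 ≤ U →
      (((0) - s) * ((-0.2666428382 : ℝ) + (-7455 / 4096) * n₁) + (s - (-1 / 5)) * ((-0.4048981559 : ℝ) + (-3813 / 2048) * n₁)) / ((0) - (-1 / 5)) ≤
        energyDensityTT' 1 s U n₁ :=
  floor_on_cell_of_tPrime_end_rows 1 hn0 hn2 (by norm_num)
    (fun _ hU => fermiSeaTangentRow_tPrime_neg_one_div_five_at_two_div_five hU hn0 hn2)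
    (fun _ hU => fermiSeaTangentRow_tPrime_zero_at_two_div_five hU hn0 hn2)

/-! ## §3 `(≤ 2/5 | ≥ 1)` on each `t′`-cell: columns `[U₁, 8]`, above `[8, U₃]`, the cell; then the whole strip -/

/-- **Cell L columns: `(≤ 2/5 | ≥ 1)`, `t′ ∈ [-3/10, -1/4]`, `U ∈ [15/2, 8]`** (mean density `3/4`, weights `5/12, 7/12`; cap r450 plane;
`n = 1` laws at `15/2` (chord) and `8`; dilute floor `strip25_dilute_floor_left`; column margins `≥ 0.0011394954` / `≥ 0.0152020468`). [cite: Israel1979, Thm. I.2.4] [cite: EmeryKivelsonLin1990, pp. 475–476] [cite: Ruelle1969, §3.3] -/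
theorem strip25_ps_L_columns (h450 : cert_r450_openbox_32x4_N96_planes)
    (hK29 : cert_laBoxE_K2diag_GU29o5n1tpm3o10_j295889_up) (hK8 : cert_laBoxE_K2diag_GU8n1tpm3o10_j299783_up)
    (h21 : cert_r21_luc_tl_upper_n1_U6) (h487 : cert_r487_hubSQ_hanK7R6_U10_r5_e4_so4blk)
    (h427 : cert_r427_hubSQ_hanK7_U5_r5_e4_so4blk) (h488 : cert_r488_hubSQ_hanK7R6_U6_r5_e4_so4blk)
    (h472 : cert_r472_pb2_tl_upper_n1_U8) (h428 : cert_r428_hubSQ_hanK7R6_U8_r5_e4_so4blk)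
    {s : ℝ} (hs : s ∈ Icc (-3 / 10 : ℝ) (-1 / 4)) {U : ℝ} (hU : U ∈ Icc (15 / 2 : ℝ) 8)
    {ω₁ ω₂ : InfVolFermionState 2} (h₁ : ω₁.IsTranslationInvariant) (h₂ : ω₂.IsTranslationInvariant)
    (hρ₁ : 0 < ω₁.density) (hρ₁' : ω₁.density ≤ 2 / 5) (hρ₂ : 1 ≤ ω₂.density) (hρ₂' : ω₂.density < 2)
    {lam : ℝ} (hl0 : 0 < lam) (hl1 : lam < 1) :
    energyDensityTT' 1 s U (mix lam hl0.le hl1.le ω₁ ω₂).density <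
      (mix lam hl0.le hl1.le ω₁ ω₂).meanEnergy (hubbardTTPrimeFermionInteraction 1 s U) 1 := by
  refine ps_not_groundState_mix_on_cell_of_columns_tcap 1 (s₁ := -3 / 10) (s₂ := -1 / 4) (U₁ := 15 / 2) (U₂ := 8)
    (n₁ := 2 / 5) (n₂ := 1) (a := 5 / 12) (b := 7 / 12) (by norm_num) (by norm_num) (by norm_num) (by norm_num)
    (by norm_num) (by norm_num) (by norm_num) (by norm_num)
    (r450_capPlane_tcap_on_cell_of h450 (by norm_num) (by norm_num) (by norm_num))
    (fun s hs => lsco_n1_lawAt_of hK29 hK8 h21 h487 h427 h488 h472 h428 (U₀ := 15 / 2) (by norm_num) s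
      ⟨hs.1.trans' (by norm_num), hs.2.trans (by norm_num)⟩)
    (fun s hs => lsco_n1_law8_of hK8 h472 h428 s ⟨hs.1.trans' (by norm_num), hs.2.trans (by norm_num)⟩)
    (fun s hs U hU => strip25_dilute_floor_left (n₁ := 2 / 5) (by norm_num) (by norm_num) s hs U (by linarith [hU.1]))
    ?_ ?_ hs hU h₁ h₂ hρ₁ hρ₁' hρ₂ hρ₂' hl0 hl1
  · intro s hs; obtain ⟨h1, h2⟩ := hs; push_cast; norm_num; nlinarith [h1, h2]
  · intro s hs; obtain ⟨h1, h2⟩ := hs; push_cast; norm_num; nlinarith [h1, h2]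

/-- **Cell L above the column: `(≤ 2/5 | ≥ 1)`, `t′ ∈ [-3/10, -1/4]`, `U ∈ [8, 17/2]`** (Griffiths; cap slope `c₁ = 0.0281698162…` per unit `U`;
far-end margin `≥ 0.0011171386`). [cite: Israel1979, Thm. I.2.4] [cite: Griffiths1966, §II] -/
theorem strip25_ps_L_above (h450 : cert_r450_openbox_32x4_N96_planes)
    (hK8 : cert_laBoxE_K2diag_GU8n1tpm3o10_j299783_up)
    (h472 : cert_r472_pb2_tl_upper_n1_U8) (h428 : cert_r428_hubSQ_hanK7R6_U8_r5_e4_so4blk)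
    {s : ℝ} (hs : s ∈ Icc (-3 / 10 : ℝ) (-1 / 4)) {U : ℝ} (hU : U ∈ Icc (8 : ℝ) (17 / 2 : ℝ))
    {ω₁ ω₂ : InfVolFermionState 2} (h₁ : ω₁.IsTranslationInvariant) (h₂ : ω₂.IsTranslationInvariant)
    (hρ₁ : 0 < ω₁.density) (hρ₁' : ω₁.density ≤ 2 / 5) (hρ₂ : 1 ≤ ω₂.density) (hρ₂' : ω₂.density < 2)
    {lam : ℝ} (hl0 : 0 < lam) (hl1 : lam < 1) :
    energyDensityTT' 1 s U (mix lam hl0.le hl1.le ω₁ ω₂).density <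
      (mix lam hl0.le hl1.le ω₁ ω₂).meanEnergy (hubbardTTPrimeFermionInteraction 1 s U) 1 := by
  refine ps_not_groundState_mix_above_column_tcap 1 (s₁ := -3 / 10) (s₂ := -1 / 4) (U₂ := 8) (U₃ := 17 / 2)
    (n₁ := 2 / 5) (n₂ := 1) (a := 5 / 12) (b := 7 / 12) (by norm_num) (by norm_num) (by norm_num) (by norm_num)
    (by norm_num) (by norm_num) (by norm_num) (by norm_num)
    (r450_capPlane_tcap_on_cell_of h450 (by norm_num) (by norm_num) (by norm_num))
    (fun s hs => lsco_n1_law8_of hK8 h472 h428 s ⟨hs.1.trans' (by norm_num), hs.2.trans (by norm_num)⟩)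
    (fun s hs U hU => strip25_dilute_floor_left (n₁ := 2 / 5) (by norm_num) (by norm_num) s hs U (by linarith [hU.1]))
    ?_ hs hU h₁ h₂ hρ₁ hρ₁' hρ₂ hρ₂' hl0 hl1
  intro s hs; obtain ⟨h1, h2⟩ := hs; push_cast; norm_num; nlinarith [h1, h2]

/-- **Cell L: THE `(≤ 2/5 | ≥ 1)` SENTENCE on `t′ ∈ [-3/10, -1/4] × U ∈ [15/2, 17/2]`.** For every `(s, U)` of the cell no mixture
`λω₁ + (1−λ)ω₂` (`0 < λ < 1`) of translation-invariant states of the 2D `t–t′` Hubbard model at `(1, s, U)` with densities `0 < ρ(ω₁) ≤ 2/5`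
and `1 ≤ ρ(ω₂) < 2` is a ground state (at any filling in between). Conditional BY NAME on the r450 plane node, the two K2DIAG-A nodes and
#21 · #487 · #427 · #488 · #472 · #428; dilute floors premise-free. [cite: Israel1979, Thm. I.2.4] [cite: EmeryKivelsonLin1990, pp. 475–476] [cite: Ruelle1969, §3.3] -/
theorem strip25_not_groundState_mix_le_2o5_ge_one_L (h450 : cert_r450_openbox_32x4_N96_planes)
    (hK29 : cert_laBoxE_K2diag_GU29o5n1tpm3o10_j295889_up) (hK8 : cert_laBoxE_K2diag_GU8n1tpm3o10_j299783_up)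
    (h21 : cert_r21_luc_tl_upper_n1_U6) (h487 : cert_r487_hubSQ_hanK7R6_U10_r5_e4_so4blk)
    (h427 : cert_r427_hubSQ_hanK7_U5_r5_e4_so4blk) (h488 : cert_r488_hubSQ_hanK7R6_U6_r5_e4_so4blk)
    (h472 : cert_r472_pb2_tl_upper_n1_U8) (h428 : cert_r428_hubSQ_hanK7R6_U8_r5_e4_so4blk)
    {s : ℝ} (hs : s ∈ Icc (-3 / 10 : ℝ) (-1 / 4)) {U : ℝ} (hU : U ∈ Icc (15 / 2 : ℝ) (17 / 2 : ℝ))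
    {ω₁ ω₂ : InfVolFermionState 2} (h₁ : ω₁.IsTranslationInvariant) (h₂ : ω₂.IsTranslationInvariant)
    (hρ₁ : 0 < ω₁.density) (hρ₁' : ω₁.density ≤ 2 / 5) (hρ₂ : 1 ≤ ω₂.density) (hρ₂' : ω₂.density < 2)
    {lam : ℝ} (hl0 : 0 < lam) (hl1 : lam < 1) :
    energyDensityTT' 1 s U (mix lam hl0.le hl1.le ω₁ ω₂).density <
      (mix lam hl0.le hl1.le ω₁ ω₂).meanEnergy (hubbardTTPrimeFermionInteraction 1 s U) 1 := by
  rcases le_total U 8 with hUl | hUr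
  · exact strip25_ps_L_columns h450 hK29 hK8 h21 h487 h427 h488 h472 h428 hs ⟨hU.1, hUl⟩ h₁ h₂ hρ₁ hρ₁' hρ₂ hρ₂' hl0 hl1
  · exact strip25_ps_L_above h450 hK8 h472 h428 hs ⟨hUr, hU.2⟩ h₁ h₂ hρ₁ hρ₁' hρ₂ hρ₂' hl0 hl1

/-- **Cell M columns: `(≤ 2/5 | ≥ 1)`, `t′ ∈ [-1/4, -1/5]`, `U ∈ [71/10, 8]`** (mean density `3/4`, weights `5/12, 7/12`; cap r450 plane;
`n = 1` laws at `71/10` (chord) and `8`; dilute floor `strip25_dilute_floor_mid`; column margins `≥ 0.0004653269` / `≥ 0.0237622386`). [cite: Israel1979, Thm. I.2.4] [cite: EmeryKivelsonLin1990, pp. 475–476] [cite: Ruelle1969, §3.3] -/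
theorem strip25_ps_M_columns (h450 : cert_r450_openbox_32x4_N96_planes)
    (hK29 : cert_laBoxE_K2diag_GU29o5n1tpm3o10_j295889_up) (hK8 : cert_laBoxE_K2diag_GU8n1tpm3o10_j299783_up)
    (h21 : cert_r21_luc_tl_upper_n1_U6) (h487 : cert_r487_hubSQ_hanK7R6_U10_r5_e4_so4blk)
    (h427 : cert_r427_hubSQ_hanK7_U5_r5_e4_so4blk) (h488 : cert_r488_hubSQ_hanK7R6_U6_r5_e4_so4blk)
    (h472 : cert_r472_pb2_tl_upper_n1_U8) (h428 : cert_r428_hubSQ_hanK7R6_U8_r5_e4_so4blk)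
    {s : ℝ} (hs : s ∈ Icc (-1 / 4 : ℝ) (-1 / 5)) {U : ℝ} (hU : U ∈ Icc (71 / 10 : ℝ) 8)
    {ω₁ ω₂ : InfVolFermionState 2} (h₁ : ω₁.IsTranslationInvariant) (h₂ : ω₂.IsTranslationInvariant)
    (hρ₁ : 0 < ω₁.density) (hρ₁' : ω₁.density ≤ 2 / 5) (hρ₂ : 1 ≤ ω₂.density) (hρ₂' : ω₂.density < 2)
    {lam : ℝ} (hl0 : 0 < lam) (hl1 : lam < 1) :
    energyDensityTT' 1 s U (mix lam hl0.le hl1.le ω₁ ω₂).density <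
      (mix lam hl0.le hl1.le ω₁ ω₂).meanEnergy (hubbardTTPrimeFermionInteraction 1 s U) 1 := by
  refine ps_not_groundState_mix_on_cell_of_columns_tcap 1 (s₁ := -1 / 4) (s₂ := -1 / 5) (U₁ := 71 / 10) (U₂ := 8)
    (n₁ := 2 / 5) (n₂ := 1) (a := 5 / 12) (b := 7 / 12) (by norm_num) (by norm_num) (by norm_num) (by norm_num)
    (by norm_num) (by norm_num) (by norm_num) (by norm_num)
    (r450_capPlane_tcap_on_cell_of h450 (by norm_num) (by norm_num) (by norm_num))
    (fun s hs => lsco_n1_lawAt_of hK29 hK8 h21 h487 h427 h488 h472 h428 (U₀ := 71 / 10) (by norm_num) s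
      ⟨hs.1.trans' (by norm_num), hs.2.trans (by norm_num)⟩)
    (fun s hs => lsco_n1_law8_of hK8 h472 h428 s ⟨hs.1.trans' (by norm_num), hs.2.trans (by norm_num)⟩)
    (fun s hs U hU => strip25_dilute_floor_mid (n₁ := 2 / 5) (by norm_num) (by norm_num) s hs U (by linarith [hU.1]))
    ?_ ?_ hs hU h₁ h₂ hρ₁ hρ₁' hρ₂ hρ₂' hl0 hl1
  · intro s hs; obtain ⟨h1, h2⟩ := hs; push_cast; norm_num; nlinarith [h1, h2]
  · intro s hs; obtain ⟨h1, h2⟩ := hs; push_cast; norm_num; nlinarith [h1, h2]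

/-- **Cell M above the column: `(≤ 2/5 | ≥ 1)`, `t′ ∈ [-1/4, -1/5]`, `U ∈ [8, 44/5]`** (Griffiths; cap slope `c₁ = 0.0281698162…` per unit `U`;
far-end margin `≥ 0.0012263856`). [cite: Israel1979, Thm. I.2.4] [cite: Griffiths1966, §II] -/
theorem strip25_ps_M_above (h450 : cert_r450_openbox_32x4_N96_planes)
    (hK8 : cert_laBoxE_K2diag_GU8n1tpm3o10_j299783_up)
    (h472 : cert_r472_pb2_tl_upper_n1_U8) (h428 : cert_r428_hubSQ_hanK7R6_U8_r5_e4_so4blk)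
    {s : ℝ} (hs : s ∈ Icc (-1 / 4 : ℝ) (-1 / 5)) {U : ℝ} (hU : U ∈ Icc (8 : ℝ) (44 / 5 : ℝ))
    {ω₁ ω₂ : InfVolFermionState 2} (h₁ : ω₁.IsTranslationInvariant) (h₂ : ω₂.IsTranslationInvariant)
    (hρ₁ : 0 < ω₁.density) (hρ₁' : ω₁.density ≤ 2 / 5) (hρ₂ : 1 ≤ ω₂.density) (hρ₂' : ω₂.density < 2)
    {lam : ℝ} (hl0 : 0 < lam) (hl1 : lam < 1) :
    energyDensityTT' 1 s U (mix lam hl0.le hl1.le ω₁ ω₂).density <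
      (mix lam hl0.le hl1.le ω₁ ω₂).meanEnergy (hubbardTTPrimeFermionInteraction 1 s U) 1 := by
  refine ps_not_groundState_mix_above_column_tcap 1 (s₁ := -1 / 4) (s₂ := -1 / 5) (U₂ := 8) (U₃ := 44 / 5)
    (n₁ := 2 / 5) (n₂ := 1) (a := 5 / 12) (b := 7 / 12) (by norm_num) (by norm_num) (by norm_num) (by norm_num)
    (by norm_num) (by norm_num) (by norm_num) (by norm_num)
    (r450_capPlane_tcap_on_cell_of h450 (by norm_num) (by norm_num) (by norm_num))
    (fun s hs => lsco_n1_law8_of hK8 h472 h428 s ⟨hs.1.trans' (by norm_num), hs.2.trans (by norm_num)⟩)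
    (fun s hs U hU => strip25_dilute_floor_mid (n₁ := 2 / 5) (by norm_num) (by norm_num) s hs U (by linarith [hU.1]))
    ?_ hs hU h₁ h₂ hρ₁ hρ₁' hρ₂ hρ₂' hl0 hl1
  intro s hs; obtain ⟨h1, h2⟩ := hs; push_cast; norm_num; nlinarith [h1, h2]

/-- **Cell M: THE `(≤ 2/5 | ≥ 1)` SENTENCE on `t′ ∈ [-1/4, -1/5] × U ∈ [71/10, 44/5]`.** For every `(s, U)` of the cell no mixture
`λω₁ + (1−λ)ω₂` (`0 < λ < 1`) of translation-invariant states of the 2D `t–t′` Hubbard model at `(1, s, U)` with densities `0 < ρ(ω₁) ≤ 2/5`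
and `1 ≤ ρ(ω₂) < 2` is a ground state (at any filling in between). Conditional BY NAME on the r450 plane node, the two K2DIAG-A nodes and
#21 · #487 · #427 · #488 · #472 · #428; dilute floors premise-free. [cite: Israel1979, Thm. I.2.4] [cite: EmeryKivelsonLin1990, pp. 475–476] [cite: Ruelle1969, §3.3] -/
theorem strip25_not_groundState_mix_le_2o5_ge_one_M (h450 : cert_r450_openbox_32x4_N96_planes)
    (hK29 : cert_laBoxE_K2diag_GU29o5n1tpm3o10_j295889_up) (hK8 : cert_laBoxE_K2diag_GU8n1tpm3o10_j299783_up)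
    (h21 : cert_r21_luc_tl_upper_n1_U6) (h487 : cert_r487_hubSQ_hanK7R6_U10_r5_e4_so4blk)
    (h427 : cert_r427_hubSQ_hanK7_U5_r5_e4_so4blk) (h488 : cert_r488_hubSQ_hanK7R6_U6_r5_e4_so4blk)
    (h472 : cert_r472_pb2_tl_upper_n1_U8) (h428 : cert_r428_hubSQ_hanK7R6_U8_r5_e4_so4blk)
    {s : ℝ} (hs : s ∈ Icc (-1 / 4 : ℝ) (-1 / 5)) {U : ℝ} (hU : U ∈ Icc (71 / 10 : ℝ) (44 / 5 : ℝ))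
    {ω₁ ω₂ : InfVolFermionState 2} (h₁ : ω₁.IsTranslationInvariant) (h₂ : ω₂.IsTranslationInvariant)
    (hρ₁ : 0 < ω₁.density) (hρ₁' : ω₁.density ≤ 2 / 5) (hρ₂ : 1 ≤ ω₂.density) (hρ₂' : ω₂.density < 2)
    {lam : ℝ} (hl0 : 0 < lam) (hl1 : lam < 1) :
    energyDensityTT' 1 s U (mix lam hl0.le hl1.le ω₁ ω₂).density <
      (mix lam hl0.le hl1.le ω₁ ω₂).meanEnergy (hubbardTTPrimeFermionInteraction 1 s U) 1 := by
  rcases le_total U 8 with hUl | hUr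
  · exact strip25_ps_M_columns h450 hK29 hK8 h21 h487 h427 h488 h472 h428 hs ⟨hU.1, hUl⟩ h₁ h₂ hρ₁ hρ₁' hρ₂ hρ₂' hl0 hl1
  · exact strip25_ps_M_above h450 hK8 h472 h428 hs ⟨hUr, hU.2⟩ h₁ h₂ hρ₁ hρ₁' hρ₂ hρ₂' hl0 hl1

/-- **Cell R columns: `(≤ 2/5 | ≥ 1)`, `t′ ∈ [-1/5, 0]`, `U ∈ [133/20, 8]`** (mean density `3/4`, weights `5/12, 7/12`; cap r450 plane;
`n = 1` laws at `133/20` (chord) and `8`; dilute floor `strip25_dilute_floor_right`; column margins `≥ 0.0003303330` / `≥ 0.0322521796`). [cite: Israel1979, Thm. I.2.4] [cite: EmeryKivelsonLin1990, pp. 475–476] [cite: Ruelle1969, §3.3] -/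
theorem strip25_ps_R_columns (h450 : cert_r450_openbox_32x4_N96_planes)
    (hK29 : cert_laBoxE_K2diag_GU29o5n1tpm3o10_j295889_up) (hK8 : cert_laBoxE_K2diag_GU8n1tpm3o10_j299783_up)
    (h21 : cert_r21_luc_tl_upper_n1_U6) (h487 : cert_r487_hubSQ_hanK7R6_U10_r5_e4_so4blk)
    (h427 : cert_r427_hubSQ_hanK7_U5_r5_e4_so4blk) (h488 : cert_r488_hubSQ_hanK7R6_U6_r5_e4_so4blk)
    (h472 : cert_r472_pb2_tl_upper_n1_U8) (h428 : cert_r428_hubSQ_hanK7R6_U8_r5_e4_so4blk)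
    {s : ℝ} (hs : s ∈ Icc (-1 / 5 : ℝ) (0)) {U : ℝ} (hU : U ∈ Icc (133 / 20 : ℝ) 8)
    {ω₁ ω₂ : InfVolFermionState 2} (h₁ : ω₁.IsTranslationInvariant) (h₂ : ω₂.IsTranslationInvariant)
    (hρ₁ : 0 < ω₁.density) (hρ₁' : ω₁.density ≤ 2 / 5) (hρ₂ : 1 ≤ ω₂.density) (hρ₂' : ω₂.density < 2)
    {lam : ℝ} (hl0 : 0 < lam) (hl1 : lam < 1) :
    energyDensityTT' 1 s U (mix lam hl0.le hl1.le ω₁ ω₂).density <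
      (mix lam hl0.le hl1.le ω₁ ω₂).meanEnergy (hubbardTTPrimeFermionInteraction 1 s U) 1 := by
  refine ps_not_groundState_mix_on_cell_of_columns_tcap 1 (s₁ := -1 / 5) (s₂ := 0) (U₁ := 133 / 20) (U₂ := 8)
    (n₁ := 2 / 5) (n₂ := 1) (a := 5 / 12) (b := 7 / 12) (by norm_num) (by norm_num) (by norm_num) (by norm_num)
    (by norm_num) (by norm_num) (by norm_num) (by norm_num)
    (r450_capPlane_tcap_on_cell_of h450 (by norm_num) (by norm_num) (by norm_num))
    (fun s hs => lsco_n1_lawAt_of hK29 hK8 h21 h487 h427 h488 h472 h428 (U₀ := 133 / 20) (by norm_num) s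
      ⟨hs.1.trans' (by norm_num), hs.2.trans (by norm_num)⟩)
    (fun s hs => lsco_n1_law8_of hK8 h472 h428 s ⟨hs.1.trans' (by norm_num), hs.2.trans (by norm_num)⟩)
    (fun s hs U hU => strip25_dilute_floor_right (n₁ := 2 / 5) (by norm_num) (by norm_num) s hs U (by linarith [hU.1]))
    ?_ ?_ hs hU h₁ h₂ hρ₁ hρ₁' hρ₂ hρ₂' hl0 hl1
  · intro s hs; obtain ⟨h1, h2⟩ := hs; push_cast; norm_num; nlinarith [h1, h2]
  · intro s hs; obtain ⟨h1, h2⟩ := hs; push_cast; norm_num; nlinarith [h1, h2]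

/-- **Cell R above the column: `(≤ 2/5 | ≥ 1)`, `t′ ∈ [-1/5, 0]`, `U ∈ [8, 91/10]`** (Griffiths; cap slope `c₁ = 0.0281698162…` per unit `U`;
far-end margin `≥ 0.0012653817`). [cite: Israel1979, Thm. I.2.4] [cite: Griffiths1966, §II] -/
theorem strip25_ps_R_above (h450 : cert_r450_openbox_32x4_N96_planes)
    (hK8 : cert_laBoxE_K2diag_GU8n1tpm3o10_j299783_up)
    (h472 : cert_r472_pb2_tl_upper_n1_U8) (h428 : cert_r428_hubSQ_hanK7R6_U8_r5_e4_so4blk)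
    {s : ℝ} (hs : s ∈ Icc (-1 / 5 : ℝ) (0)) {U : ℝ} (hU : U ∈ Icc (8 : ℝ) (91 / 10 : ℝ))
    {ω₁ ω₂ : InfVolFermionState 2} (h₁ : ω₁.IsTranslationInvariant) (h₂ : ω₂.IsTranslationInvariant)
    (hρ₁ : 0 < ω₁.density) (hρ₁' : ω₁.density ≤ 2 / 5) (hρ₂ : 1 ≤ ω₂.density) (hρ₂' : ω₂.density < 2)
    {lam : ℝ} (hl0 : 0 < lam) (hl1 : lam < 1) :
    energyDensityTT' 1 s U (mix lam hl0.le hl1.le ω₁ ω₂).density <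
      (mix lam hl0.le hl1.le ω₁ ω₂).meanEnergy (hubbardTTPrimeFermionInteraction 1 s U) 1 := by
  refine ps_not_groundState_mix_above_column_tcap 1 (s₁ := -1 / 5) (s₂ := 0) (U₂ := 8) (U₃ := 91 / 10)
    (n₁ := 2 / 5) (n₂ := 1) (a := 5 / 12) (b := 7 / 12) (by norm_num) (by norm_num) (by norm_num) (by norm_num)
    (by norm_num) (by norm_num) (by norm_num) (by norm_num)
    (r450_capPlane_tcap_on_cell_of h450 (by norm_num) (by norm_num) (by norm_num))
    (fun s hs => lsco_n1_law8_of hK8 h472 h428 s ⟨hs.1.trans' (by norm_num), hs.2.trans (by norm_num)⟩)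
    (fun s hs U hU => strip25_dilute_floor_right (n₁ := 2 / 5) (by norm_num) (by norm_num) s hs U (by linarith [hU.1]))
    ?_ hs hU h₁ h₂ hρ₁ hρ₁' hρ₂ hρ₂' hl0 hl1
  intro s hs; obtain ⟨h1, h2⟩ := hs; push_cast; norm_num; nlinarith [h1, h2]

/-- **Cell R: THE `(≤ 2/5 | ≥ 1)` SENTENCE on `t′ ∈ [-1/5, 0] × U ∈ [133/20, 91/10]`.** For every `(s, U)` of the cell no mixture
`λω₁ + (1−λ)ω₂` (`0 < λ < 1`) of translation-invariant states of the 2D `t–t′` Hubbard model at `(1, s, U)` with densities `0 < ρ(ω₁) ≤ 2/5`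
and `1 ≤ ρ(ω₂) < 2` is a ground state (at any filling in between). Conditional BY NAME on the r450 plane node, the two K2DIAG-A nodes and
#21 · #487 · #427 · #488 · #472 · #428; dilute floors premise-free. [cite: Israel1979, Thm. I.2.4] [cite: EmeryKivelsonLin1990, pp. 475–476] [cite: Ruelle1969, §3.3] -/
theorem strip25_not_groundState_mix_le_2o5_ge_one_R (h450 : cert_r450_openbox_32x4_N96_planes)
    (hK29 : cert_laBoxE_K2diag_GU29o5n1tpm3o10_j295889_up) (hK8 : cert_laBoxE_K2diag_GU8n1tpm3o10_j299783_up)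
    (h21 : cert_r21_luc_tl_upper_n1_U6) (h487 : cert_r487_hubSQ_hanK7R6_U10_r5_e4_so4blk)
    (h427 : cert_r427_hubSQ_hanK7_U5_r5_e4_so4blk) (h488 : cert_r488_hubSQ_hanK7R6_U6_r5_e4_so4blk)
    (h472 : cert_r472_pb2_tl_upper_n1_U8) (h428 : cert_r428_hubSQ_hanK7R6_U8_r5_e4_so4blk)
    {s : ℝ} (hs : s ∈ Icc (-1 / 5 : ℝ) (0)) {U : ℝ} (hU : U ∈ Icc (133 / 20 : ℝ) (91 / 10 : ℝ))
    {ω₁ ω₂ : InfVolFermionState 2} (h₁ : ω₁.IsTranslationInvariant) (h₂ : ω₂.IsTranslationInvariant)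
    (hρ₁ : 0 < ω₁.density) (hρ₁' : ω₁.density ≤ 2 / 5) (hρ₂ : 1 ≤ ω₂.density) (hρ₂' : ω₂.density < 2)
    {lam : ℝ} (hl0 : 0 < lam) (hl1 : lam < 1) :
    energyDensityTT' 1 s U (mix lam hl0.le hl1.le ω₁ ω₂).density <
      (mix lam hl0.le hl1.le ω₁ ω₂).meanEnergy (hubbardTTPrimeFermionInteraction 1 s U) 1 := by
  rcases le_total U 8 with hUl | hUr
  · exact strip25_ps_R_columns h450 hK29 hK8 h21 h487 h427 h488 h472 h428 hs ⟨hU.1, hUl⟩ h₁ h₂ hρ₁ hρ₁' hρ₂ hρ₂' hl0 hl1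
  · exact strip25_ps_R_above h450 hK8 h472 h428 hs ⟨hUr, hU.2⟩ h₁ h₂ hρ₁ hρ₁' hρ₂ hρ₂' hl0 hl1

/-- **THE `(≤ 2/5 | ≥ 1)` SENTENCE ON THE WHOLE CUPRATE STRIP `t′ ∈ [−3/10, 0] × U ∈ [15/2, 17/2]`** (`t = 1`; union of the three
`t′`-cells L `[−3/10, −1/4]`, M `[−1/4, −1/5]`, R `[−1/5, 0]` on their common `U`-range): for every `(s, U)` of the strip, NO ground state of the
2D `t–t′` Hubbard model — at any filling, in particular `7/8` and `3/4` — is a macroscopic mixture of a translation-invariant state of density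
`≤ 2/5` (hole doping `≥ 60 %`) and one of density `≥ 1` (half filled or denser). The strongest certified `(≤ n₁ | ≥ 1)` threshold off the
`t′ = 0` axis to date (`3/10` before). Same claim nodes BY NAME as the cells. [cite: Israel1979, Thm. I.2.4] [cite: EmeryKivelsonLin1990, pp. 475–476] [cite: Ruelle1969, §3.3] -/
theorem cuprateStrip_not_groundState_mix_le_2o5_ge_one (h450 : cert_r450_openbox_32x4_N96_planes)
    (hK29 : cert_laBoxE_K2diag_GU29o5n1tpm3o10_j295889_up) (hK8 : cert_laBoxE_K2diag_GU8n1tpm3o10_j299783_up)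
    (h21 : cert_r21_luc_tl_upper_n1_U6) (h487 : cert_r487_hubSQ_hanK7R6_U10_r5_e4_so4blk)
    (h427 : cert_r427_hubSQ_hanK7_U5_r5_e4_so4blk) (h488 : cert_r488_hubSQ_hanK7R6_U6_r5_e4_so4blk)
    (h472 : cert_r472_pb2_tl_upper_n1_U8) (h428 : cert_r428_hubSQ_hanK7R6_U8_r5_e4_so4blk)
    {s : ℝ} (hs : s ∈ Icc (-3 / 10 : ℝ) 0) {U : ℝ} (hU : U ∈ Icc (15 / 2 : ℝ) (17 / 2 : ℝ))
    {ω₁ ω₂ : InfVolFermionState 2} (h₁ : ω₁.IsTranslationInvariant) (h₂ : ω₂.IsTranslationInvariant)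
    (hρ₁ : 0 < ω₁.density) (hρ₁' : ω₁.density ≤ 2 / 5) (hρ₂ : 1 ≤ ω₂.density) (hρ₂' : ω₂.density < 2)
    {lam : ℝ} (hl0 : 0 < lam) (hl1 : lam < 1) :
    energyDensityTT' 1 s U (mix lam hl0.le hl1.le ω₁ ω₂).density <
      (mix lam hl0.le hl1.le ω₁ ω₂).meanEnergy (hubbardTTPrimeFermionInteraction 1 s U) 1 := by
  rcases le_total s (-1 / 4) with hl | hr
  · exact strip25_not_groundState_mix_le_2o5_ge_one_L h450 hK29 hK8 h21 h487 h427 h488 h472 h428 ⟨hs.1, hl⟩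
      ⟨hU.1.trans' (by norm_num), hU.2.trans (by norm_num)⟩ h₁ h₂ hρ₁ hρ₁' hρ₂ hρ₂' hl0 hl1
  · rcases le_total s (-1 / 5) with hl' | hr'
    · exact strip25_not_groundState_mix_le_2o5_ge_one_M h450 hK29 hK8 h21 h487 h427 h488 h472 h428 ⟨hr, hl'⟩
        ⟨hU.1.trans' (by norm_num), hU.2.trans (by norm_num)⟩ h₁ h₂ hρ₁ hρ₁' hρ₂ hρ₂' hl0 hl1
    · exact strip25_not_groundState_mix_le_2o5_ge_one_R h450 hK29 hK8 h21 h487 h427 h488 h472 h428 ⟨hr', hs.2⟩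
        ⟨hU.1.trans' (by norm_num), hU.2.trans (by norm_num)⟩ h₁ h₂ hρ₁ hρ₁' hρ₂ hρ₂' hl0 hl1

/-! ## ERRATUM (hubbard-box-p3 g27, 2026-08-28; citation hygiene only, nothing above changes): every `[cite: Griffiths1966, §II]` tag in this file (header l.42, l.91–92, 203–204, 267–268, 331–332 — the `U`-monotonicity steps «a column law floors every larger `U` (Griffiths)») is MIS-KEYED (`Griffiths1966` = Phys. Rev. 152 (1966) 240; «J. Math. Phys. 7 (1966) 1215» conflates `Griffiths1964`; neither states it); the fact used is the tree theorem `energyDensityTT'_mono_U` (operator inequality `U·Σ n↑n↓ ≥ 0` + variational principle) — READ the tag as «[folklore: `energyDensityTT'_mono_U`]». Full text: the §ERRATUM docstring of the sibling `Observables/PhaseSeparationExclusionTPrimeStripCuprate.lean` (same seat, same date); pointed out by hubbard-cov-la214-lit-1 (N17, cell INBOX 2026-08-28T21:39:20Z). -/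

end Summit.Ventures.CertifiedManyBodySolver.Observables

end
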